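import Summits.QuantumFields.YangMills.Theorems.ConvexGribovBodyCovarianceBoundWindowReduction
import Summits.QuantumFields.YangMills.Theorems.ConvexGribovBodyCovarianceBoundMomentReduction
import HarnessLib

/-!
# The Lee–Yang windows imply the two halves of `CovarianceBound` SEPARATELY
# (crux stmt-QuantumFields-8780, line `Sketch`, skeleton v7)

Route `QuantumFields/YangMills/ConvexGribovBody`, crux
`Summit.QuantumFields.YangMills.Theses.ConvexGribovBody.CovarianceBound`.

`…CovarianceBoundWindowReduction` proves `ZeroFreeWindowLie → ZeroFreeWindowPerp → CovarianceBound`. Skeleton v7 of the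
line registers instead the two minimal HALVES of the crux (`LieModeBound`, `PerpModeBound`, file
`…CovarianceBoundMomentReduction`, with `CovarianceBound ↔ LieModeBound ∧ PerpModeBound` in `…MomentConverse`). This file
records that each window is a sufficient MECHANISM for the corresponding half on its own:

* `lieModeBound_of_zeroFreeWindowLie` : `ZeroFreeWindowLie → LieModeBound` with
  `D = 4 N² κ √C / c` — symmetrised Borel–Carathéodory per real component (`stub_symmBorelCaratheodory`, `κ`) with
  Zwanziger's support `M = √C L³ irScale` (`stub_supportLie`, `C`; `𝔤` perfect by `stub_lieAlgPerfect`) and radius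
  `c·irScale/2`: the factors `irScale` cancel and `L³` is the normalisation of the half;
* `perpModeBound_of_zeroFreeWindowPerp` : `ZeroFreeWindowPerp → PerpModeBound` with
  `D = 4 N² κ (√N + 1) / c'` — trivial support `√N L³ + 1`, volume-independent radius `c'/2`, or the vanishing
  disjunct.

Together with `…MomentReduction` / `…MomentConverse` this completes the logical map of the line:
`ZeroFreeWindowLie → LieModeBound`, `ZeroFreeWindowPerp → PerpModeBound`, `LieModeBound ∧ PerpModeBound ↔ CovarianceBound`.
Nothing here is new input: all ingredients are landed stubs of the line (`stub_supMeasurable`, `stub_projSplit`, `stub_projComponents`, `stub_symmBorelCaratheodory`,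
`stub_lieAlgPerfect`, `stub_supportLie`).
-/

set_option autoImplicit false

noncomputable section

namespace Summit.QuantumFields.YangMills.Cruxes.CovarianceBound.SupportWindow

open scoped BigOperators Topology Classical MeasureTheory ProbabilityTheory Matrix ComplexConjugate
open Filter Set Function TopologicalSpace MeasureTheory
open Literature.MathematicalPhysics.QuantumFieldTheory

/-- **The `𝔤`-window gives the `𝔤`-half.** `ZeroFreeWindowLie → LieModeBound`: for every compact simple `G` and
faithful unitary `r`, `∃ β₀ ∀ β ≥ β₀ ∃ D > 0 ∃ S₀ ∀ S ≥ S₀ ∀ p j, ∫ sup_h ‖P_𝔤 Ĉ_j(p)‖²_F dμ_β ≤ D (2S+1)³`, with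
`D = 4 N² κ √C / c + 1`. -/
theorem lieModeBound_of_zeroFreeWindowLie : ZeroFreeWindowLie → LieModeBound := by
  intro hwinL
  unfold LieModeBound
  have hmeas := stub_supMeasurable
  have hbc := stub_symmBorelCaratheodory
  have hsplit := stub_projSplit
  have hcomp := stub_projComponents
  have hF1 := stub_lieAlgPerfect
  have hsupp := stub_supportLie
  intro G _ _ _ _ _ _ hG r
  obtain ⟨C, hC, hCsupp⟩ := hsupp G hG r (hF1 G hG r)
  obtain ⟨κ, hκ, hBC⟩ := hbc
  obtain ⟨β₁, hβ₁⟩ := hwinL G hG r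
  refine ⟨β₁, fun β hβ => ?_⟩
  obtain ⟨c, hc, S₁, hS₁⟩ := hβ₁ β hβ
  set N : ℕ := r.N with hN
  have hsqC : 0 < Real.sqrt C := Real.sqrt_pos.2 hC
  refine ⟨4 * (N : ℝ) ^ 2 * κ * Real.sqrt C / c + 1, by positivity, S₁, fun S hS p j => ?_⟩
  set L : ℝ := (2 * S + 1 : ℝ) with hL
  have hLpos : 0 < L := by rw [hL]; positivity
  have hL3 : 0 < L ^ 3 := by positivity
  set μ := wilson4 r β S with hμ
  have hM := hmeas G r S p j
  have hcosb : ∀ (U : GaugeConfig 4 (2 * S + 1) G) (h : Site 4 (2 * S + 1) → G),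
      IsCoulMin r S U h → froSq (cosMode r S p j U h) ≤ r.N * (2 * S + 1 : ℝ) ^ 6 :=
    fun U h _ => (hM.2.1 U h).2.1
  have hP := hsplit G r S p j
  -- the window's selection
  obtain ⟨sel, hselm, hselmin, hselsup, hselwin⟩ := hS₁ S hS p j
  have hirr : 0 < irScale S p := irScale_pos S p
  -- per-component second moments by Borel–Carathéodory
  set ML : ℝ := Real.sqrt C * L ^ 3 * irScale S p with hML
  have hMLpos : 0 < ML := by positivity
  set RL : ℝ := c * irScale S p / 2 with hRL
  have hRLpos : 0 < RL := by positivity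
  obtain ⟨hsumL, hmeasc, hdom⟩ := (hcomp G r β S p j sel hselm hselmin hcosb).1 hselsup hP.2.1
  have hcompL : ∀ (a b : Fin r.N) (q : Bool),
      ∫ U, (lieCosComp r S p j a b q sel U) ^ 2 ∂μ ≤ κ * ML / RL := by
    intro a b q
    refine secondMoment_le_of_zeroFree hBC μ (lieCosComp r S p j a b q sel) hMLpos hRLpos (hmeasc a b q)
      ?_ ?_
    · intro U
      have h1 := hdom a b q U
      have h2 := hCsupp S U (sel U) (hselmin U) p j
      calc (lieCosComp r S p j a b q sel U) ^ 2
          ≤ froSq (lieCosMode r S p j U (sel U)) := h1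
        _ ≤ C * (2 * S + 1 : ℝ) ^ 6 * (latMomSq S p + (2 * Real.pi / (2 * S + 1)) ^ 2) := h2
        _ = ML ^ 2 := by
            rw [hML, mul_pow, mul_pow, Real.sq_sqrt hC.le, irScale_sq]; ring
    · intro z hz
      have hz' : ‖z‖ < c * irScale S p := by rw [hRL] at hz; linarith
      exact hselwin a b q z hz'
  have hκL : κ * ML / RL = 2 * κ * Real.sqrt C * L ^ 3 / c := by rw [hML, hRL]; field_simp
  have hL' : ∫ U, supLieCosSq r S p j U ∂μ ≤ 2 * (N : ℝ) ^ 2 * (κ * ML / RL) := by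
    rw [hsumL]
    calc ∑ a : Fin r.N, ∑ b : Fin r.N, ∑ q : Bool, ∫ U, (lieCosComp r S p j a b q sel U) ^ 2 ∂μ
        ≤ ∑ a : Fin r.N, ∑ b : Fin r.N, ∑ q : Bool, κ * ML / RL :=
          Finset.sum_le_sum fun a _ => Finset.sum_le_sum fun b _ =>
            Finset.sum_le_sum fun q _ => hcompL a b q
      _ = 2 * (N : ℝ) ^ 2 * (κ * ML / RL) := by
          simp only [Finset.sum_const, Finset.card_univ, Fintype.card_bool, Fintype.card_fin, hN]
          ring
  rw [hκL] at hL'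
  have hkey : 2 * (N : ℝ) ^ 2 * (2 * κ * Real.sqrt C * L ^ 3 / c) =
      (4 * (N : ℝ) ^ 2 * κ * Real.sqrt C / c) * L ^ 3 := by ring
  rw [hkey] at hL'
  have hextra : (4 * (N : ℝ) ^ 2 * κ * Real.sqrt C / c) * L ^ 3 ≤
      (4 * (N : ℝ) ^ 2 * κ * Real.sqrt C / c + 1) * L ^ 3 := by nlinarith
  exact hL'.trans hextra

/-- **The `𝔤^⊥`-window gives the `𝔤^⊥`-half.** `ZeroFreeWindowPerp → PerpModeBound`: for every compact simple `G`
and faithful unitary `r`, `∃ β₀ ∀ β ≥ β₀ ∃ D > 0 ∃ S₀ ∀ S ≥ S₀ ∀ p j, ∫ sup_h ‖Ĉ_j(p) − P_𝔤 Ĉ_j(p)‖²_F dμ_β ≤ D (2S+1)³`,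
with `D = 4 N² κ (√N + 1) / c' + 1` (or trivially when the `𝔤^⊥`-part vanishes). -/
theorem perpModeBound_of_zeroFreeWindowPerp : ZeroFreeWindowPerp → PerpModeBound := by
  intro hwinP
  unfold PerpModeBound
  have hmeas := stub_supMeasurable
  have hbc := stub_symmBorelCaratheodory
  have hsplit := stub_projSplit
  have hcomp := stub_projComponents
  intro G _ _ _ _ _ _ hG r
  obtain ⟨κ, hκ, hBC⟩ := hbc
  obtain ⟨β₂, hβ₂⟩ := hwinP G hG r
  refine ⟨β₂, fun β hβ => ?_⟩
  obtain ⟨c', hc', S₂, hS₂⟩ := hβ₂ β hβ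
  set N : ℕ := r.N with hN
  have hNpos' : (0 : ℝ) ≤ (N : ℝ) := by positivity
  refine ⟨4 * (N : ℝ) ^ 2 * κ * (Real.sqrt N + 1) / c' + 1, by positivity, S₂, fun S hS p j => ?_⟩
  set L : ℝ := (2 * S + 1 : ℝ) with hL
  have hLpos : 0 < L := by rw [hL]; positivity
  have hL3 : 0 < L ^ 3 := by positivity
  set μ := wilson4 r β S with hμ
  have hM := hmeas G r S p j
  have hcosb : ∀ (U : GaugeConfig 4 (2 * S + 1) G) (h : Site 4 (2 * S + 1) → G),
      IsCoulMin r S U h → froSq (cosMode r S p j U h) ≤ r.N * (2 * S + 1 : ℝ) ^ 6 :=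
    fun U h _ => (hM.2.1 U h).2.1
  have hP := hsplit G r S p j
  have hDpos : 0 < 4 * (N : ℝ) ^ 2 * κ * (Real.sqrt N + 1) / c' + 1 := by positivity
  rcases hS₂ S hS p j with hzero | ⟨selP, hselPm, hselPmin, hselPsup, hselPwin⟩
  · -- the `𝔤^⊥`-part vanishes identically
    have h0 : (fun U => supPerpCosSq r S p j U) = fun _ => (0 : ℝ) := funext hzero
    have hz : ∫ U, supPerpCosSq r S p j U ∂μ = 0 := by rw [h0]; simp
    rw [hz]
    positivity
  · -- trivial support `√N L³ + 1`, radius `c'/2`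
    set MP : ℝ := Real.sqrt N * L ^ 3 + 1 with hMP
    have hMPpos : 0 < MP := by positivity
    set RP : ℝ := c' / 2 with hRP
    have hRPpos : 0 < RP := by positivity
    obtain ⟨hsumP, hmeasc, hdom⟩ := (hcomp G r β S p j selP hselPm hselPmin hcosb).2 hselPsup hP.2.2.1
    have hcompP : ∀ (a b : Fin r.N) (q : Bool),
        ∫ U, (perpCosComp r S p j a b q selP U) ^ 2 ∂μ ≤ κ * MP / RP := by
      intro a b q
      refine secondMoment_le_of_zeroFree hBC μ (perpCosComp r S p j a b q selP) hMPpos hRPpos (hmeasc a b q)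
        ?_ ?_
      · intro U
        have h1 := hdom a b q U
        have hsplitU := hP.1 U (selP U)
        have h3 := hcosb U (selP U) (hselPmin U)
        have hnnL : 0 ≤ froSq (lieCosMode r S p j U (selP U)) := by
          unfold froSq; exact Finset.sum_nonneg fun a _ => Finset.sum_nonneg fun b _ => by positivity
        have h4 : froSq (perpCosMode r S p j U (selP U)) ≤ r.N * (2 * S + 1 : ℝ) ^ 6 := by linarith
        have h5 : (r.N : ℝ) * (2 * S + 1 : ℝ) ^ 6 ≤ MP ^ 2 := by
          have hsq : Real.sqrt (N : ℝ) ^ 2 = (N : ℝ) := Real.sq_sqrt hNpos'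
          have hNN : (r.N : ℝ) = (N : ℝ) := by rw [hN]
          have hL6 : (2 * S + 1 : ℝ) ^ 6 = L ^ 3 * L ^ 3 := by rw [hL]; ring
          rw [hNN, hL6, hMP]
          nlinarith [hsq, hL3, Real.sqrt_nonneg (N : ℝ), mul_nonneg (Real.sqrt_nonneg (N : ℝ)) hL3.le]
        calc (perpCosComp r S p j a b q selP U) ^ 2
            ≤ froSq (perpCosMode r S p j U (selP U)) := h1
          _ ≤ MP ^ 2 := by linarith [h4, h5]
      · intro z hz
        have hz' : ‖z‖ < c' := by rw [hRP] at hz; linarith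
        exact hselPwin a b q z hz'
    have hκP : κ * MP / RP = 2 * κ * MP / c' := by rw [hRP]; field_simp
    have hPb : ∫ U, supPerpCosSq r S p j U ∂μ ≤ 2 * (N : ℝ) ^ 2 * (κ * MP / RP) := by
      rw [hsumP]
      calc ∑ a : Fin r.N, ∑ b : Fin r.N, ∑ q : Bool, ∫ U, (perpCosComp r S p j a b q selP U) ^ 2 ∂μ
          ≤ ∑ a : Fin r.N, ∑ b : Fin r.N, ∑ q : Bool, κ * MP / RP :=
            Finset.sum_le_sum fun a _ => Finset.sum_le_sum fun b _ =>
              Finset.sum_le_sum fun q _ => hcompP a b q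
        _ = 2 * (N : ℝ) ^ 2 * (κ * MP / RP) := by
            simp only [Finset.sum_const, Finset.card_univ, Fintype.card_bool, Fintype.card_fin, hN]
            ring
    rw [hκP] at hPb
    -- `MP ≤ (√N + 1) L³`
    have hMPle : MP ≤ (Real.sqrt N + 1) * L ^ 3 := by
      have h1 : (1 : ℝ) ≤ L := by
        rw [hL]
        have h0 : (0 : ℝ) ≤ 2 * (S : ℝ) := by positivity
        linarith
      have h13 : (1 : ℝ) ≤ L ^ 3 := one_le_pow₀ h1
      rw [hMP]
      nlinarith [Real.sqrt_nonneg (N : ℝ), h13]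
    have h3 : 0 ≤ 2 * (N : ℝ) ^ 2 * (2 * κ) / c' := by positivity
    have hstep : 2 * (N : ℝ) ^ 2 * (2 * κ * MP / c') ≤
        (4 * (N : ℝ) ^ 2 * κ * (Real.sqrt N + 1) / c') * L ^ 3 := by
      have e1 : 2 * (N : ℝ) ^ 2 * (2 * κ * MP / c') = (2 * (N : ℝ) ^ 2 * (2 * κ) / c') * MP := by ring
      have e2 : (4 * (N : ℝ) ^ 2 * κ * (Real.sqrt N + 1) / c') * L ^ 3 =
          (2 * (N : ℝ) ^ 2 * (2 * κ) / c') * ((Real.sqrt N + 1) * L ^ 3) := by ring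
      rw [e1, e2]
      exact mul_le_mul_of_nonneg_left hMPle h3
    have hextra : (4 * (N : ℝ) ^ 2 * κ * (Real.sqrt N + 1) / c') * L ^ 3 ≤
        (4 * (N : ℝ) ^ 2 * κ * (Real.sqrt N + 1) / c' + 1) * L ^ 3 := by nlinarith
    exact (hPb.trans hstep).trans hextra

end Summit.QuantumFields.YangMills.Cruxes.CovarianceBound.SupportWindow

end
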